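import Summits.HubbardSuperconductivity.HubbardSuperconductivity.Theorems.KLProgrammeKLRegimeFlowReadScaleZeroSunsetCertRowsThreeShellsRecords
import Summits.HubbardSuperconductivity.HubbardSuperconductivity.Theorems.KLProgrammeKLRegimeScaleZeroMidShellFarGap
import Summits.HubbardSuperconductivity.HubbardSuperconductivity.Theorems.KLProgrammeKLRegimeFlowReadScaleZeroSunsetWindowCover

/-!
# Route `KLProgramme`, crux K3 — engine-flow child (stmt-HubbardSuperconductivity-20437), stub (C) at `n = 0`, located item #22a «(C)-SCALE0-PT2»:
# THE INNER-GAP FORMAT — the record-level one-call with the OUTER far shell PROVED, its decidable side conditions, and the one-call at EVERY `μ ∈ klWindowC`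

Seat hubbard-kl-k3c5-p1 (g18; owner of #22a).  Composition of `…SunsetCertRowsThreeShellsRecords.sunsetRows_of_records3_farSup` (two-low-shell format, (R361)(1))
with `…ScaleZeroMidShellFarGap.midShell_farGapCertOn_of_rat` (the outer shell `ω₀ ≤ |ω| < ω₁`, `ω₀ ≥ klE0 = 1/32`, is the pure resolvent; its Parseval gaps are PROVED
`≤ P(ω₀)²/(128·Rc⁸)`, `≤ P(ω₀)²/(64·Rc⁶)`, `P(q) = 6144/q⁵ + 4608/q⁴ + 896/q³ + 32/q²`), and the window glue in the pattern of `…SunsetWindowCover`: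
* §1 **`sunsetRows_of_records_innerGap_farSup`** — `hS0`/`hSk` of `…FlowReadScaleZeroAssembly.twoLegRead_frameZero_of_sunsetData` at `μ ∈ klWindowC ∩ cell`,
  `β ≥ klBetaMin`, `0 < U ≤ 2⁻²⁰`, `L ≥ klEngL₃`, `M ≥ klEngM₃` from: near record `c` + `ScaleZeroSunsetCertV3 c` (KIT JOB A / W4), INNER far-gap record `rlo` +
  `ScaleZeroFarGapCert c rlo` (KIT JOB B′ on `0 < |ω| < rlo.ω₁` ONLY, `rlo.ω₁ ≥ 1/32`), far-sup record `rs` + `ScaleZeroFarSupCert c rs` (B″, booked `Sfar = 353521920428/10¹⁶`),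
  a rational outer crossover `ω₁ ∈ [1/32, 1/4]` with `255 ≤ ω₁(Rc+1)`, rational majorants `s₀, s₂` (inner gaps) and `u₀, u₂` (PROVED outer envelopes:
  `P(rlo.ω₁)²/(128·Rc⁸) ≤ u₀²`, `P(rlo.ω₁)²/(64·Rc⁶) ≤ u₂²`), and the budget row `row k + (Sfar + 10⁻²⁹)·(2·10⁻⁸ + (rlo.ω₁(t_k + 10⁻¹⁰)² + ω₁(v_k + 10⁻¹⁰)²)) ≤ bS k`,
  `t = (s₀,(s₀+s₂)/2,s₂)`, `v = (u₀,(u₀+u₂)/2,u₂)` — NO outer-shell certificate (proof: `rmid := ⟨ω₁, u₀², u₂²⟩`);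
* §2 `SunsetCellBundle.vVec`, `SunsetCellBundle.budget3`, `SunsetCellBundle.SideOK3 b rs ω₁ u₀ u₂` (ALL rational side conditions of §1 as one proposition), `budget3_cast`
  — on the bundle type of `…SunsetWindowCover` (`b.r` := the inner record);
* §3 `sunsetRows_of_bundle_innerGap`; **`sunsetRows_window_innerGap_of_chain`** — hS0/hSk at EVERY `μ ∈ klWindowC` from a list of bundles chain-covering `[-21/20, -3/20]`
  (decidable, `exists_mem_cell_of_chain`), each with its three certificates and `SideOK3`.
INSTANTIATION RECIPE (tested on a literal sample bundle in the seat's scratch, ≈ 1 s): `simp only [SunsetCellBundle.SideOK3, SunsetCellBundle.budget3, SunsetCellBundle.tVec,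
SunsetCellBundle.vVec, <the record defs>, Matrix.cons_val_zero, Matrix.cons_val_one, Matrix.cons_val_two, Matrix.head_cons, Matrix.tail_cons]; norm_num` closes `SideOK3` on
literals (sample: Rc = 1024, cell μ* ± 1/256, rows (0.023, 0.044, 0.74), rlo = ⟨1/32, 3·10⁻³, 2·10⁴⟩, s = (0.06, 142), ω₁ = 1/4, u = (1/32, 26), bS = (0.03, 0.06, 0.78); budgets
(0.023…, 0.051, 0.768)).  SIZES [booked / float, labelled]: outer share `(Sfar+10⁻²⁹)·¼·(26+10⁻¹⁰)² ≈ 6.0·10⁻³`; inner `(Sfar+10⁻²⁹)·(1/32)·(142+10⁻¹⁰)² ≈ 0.022` [float-level G₂lo];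
high shell `≤ 2·10⁻⁸·(Sfar+10⁻²⁹)`.  What stays KIT on #22a's far side: the inner record on `(0, 1/32)` (χ₂ active) — and the near records (W4).
Definitions (§2) + proofs; the certificates are named HYPOTHESES; nothing here asserts (C), any stub of 20437, K3, the margin or superconductivity.
References: BGM 2006 §2.3 (2.17)–(2.20), §2.4, §3 (3.2) [cite: BenfattoGiulianiMastropietro2006].
-/

noncomputable section

namespace Summit.HubbardSuperconductivity.HubbardSuperconductivity.Theorems.KLRegimeSplit

set_option linter.dupNamespace false -- summit = problem name (single-conjunct summit), D-0017

open Literature.MathematicalPhysics.QuantumLattice Literature.Probability.LatticeModels Literature.Analysis.FunctionSpaces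
open Summit.HubbardSuperconductivity.HubbardSuperconductivity.Theorems.DispersionFlow
open Summit.HubbardSuperconductivity.HubbardSuperconductivity.Theorems.EngineV8
open MeasureTheory Set Finset Complex UnitAddTorus Real GrassmannAlgebra Matrix
open scoped FourierTransform Nat ENNReal NNReal

/-! ## §1 The record-level one-call, inner far-gap record only -/

section OneCall

variable {L M : ℕ} [NeZero L]


/-- **THE CERTIFIED SUNSET ROWS FROM THE NEAR RECORD, THE INNER FAR-GAP RECORD AND THE FAR-SUP RECORD — the outer far shell by theorem.**
[cite: BenfattoGiulianiMastropietro2006, §2.3 (2.17)-(2.20)] -/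
theorem sunsetRows_of_records_innerGap_farSup [NeZero M] (c : SunsetCellRecordV3) (hc : ScaleZeroSunsetCertV3 c)
    (rlo : SunsetFarGapRecord) (hrlo : ScaleZeroFarGapCert c.toSunsetCellRecordV2 rlo)
    (rs : SunsetFarSupRecord) (hrs : ScaleZeroFarSupCert c.toSunsetCellRecordV2 rs)
    {μ β U : ℝ} (hμ : μ ∈ klWindowC) (hμlo : (c.μlo : ℝ) ≤ μ) (hμhi : μ ≤ c.μhi)
    (hβ : klBetaMin ≤ β) (hU0 : 0 < U) (hU : U ≤ (2 : ℝ)⁻¹ ^ 20) (hL3 : klEngL₃ β U ≤ L) (hM3 : klEngM₃ β U L ≤ M)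
    -- rational side conditions on the near record
    (hRc' : 4 * c.Rc + 2 ≤ 2 ^ 10 * 129 ^ 2 * (2 ^ 20 + 1) ^ 2)
    (hTmax : (10 : ℚ)⁻¹ ^ 30 ≤ c.Tmax) (hrow : ∀ k : Fin 3, 0 ≤ c.row k)
    -- rational side conditions: inner crossover `ω₀ = rlo.ω₁ ≥ 1/32`, outer crossover `ω₁ ∈ [1/32, 1/4]` with `255 ≤ ω₁(Rc+1)`, majorants
    {ω₁ : ℚ} (hω₀ : (1 : ℚ) / 32 ≤ rlo.ω₁) (hω₁ : (1 : ℚ) / 32 ≤ ω₁) (hω₁' : ω₁ ≤ 1 / 4) (hωRc : 255 ≤ ω₁ * ((c.Rc : ℚ) + 1))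
    (hG₂lo : 0 ≤ rlo.G₂)
    {s₀ s₂ : ℚ} (hs₀ : rlo.G₀ ≤ s₀ ^ 2) (hs₂ : rlo.G₂ ≤ s₂ ^ 2) (hs₀0 : 0 ≤ s₀) (hs₂0 : 0 ≤ s₂)
    -- the OUTER shell is analytic: any rational `u₀, u₂ ≥ 0` above the proved envelopes `P(ω₀)²/(128·Rc⁸)`, `P(ω₀)²/(64·Rc⁶)`
    {u₀ u₂ : ℚ}
    (hu₀ : (6144 / rlo.ω₁ ^ 5 + 4608 / rlo.ω₁ ^ 4 + 896 / rlo.ω₁ ^ 3 + 32 / rlo.ω₁ ^ 2) ^ 2 / (128 * (c.Rc : ℚ) ^ 8) ≤ u₀ ^ 2)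
    (hu₂ : (6144 / rlo.ω₁ ^ 5 + 4608 / rlo.ω₁ ^ 4 + 896 / rlo.ω₁ ^ 3 + 32 / rlo.ω₁ ^ 2) ^ 2 / (64 * (c.Rc : ℚ) ^ 6) ≤ u₂ ^ 2)
    (hu₀0 : 0 ≤ u₀) (hu₂0 : 0 ≤ u₂) (hSfar : 0 ≤ rs.Sfar)
    -- the budget row
    {bS : ℕ → ℝ}
    (hbS : ∀ k : Fin 3, (c.row k : ℝ) +
      ((rs.Sfar : ℝ) + (10 : ℝ)⁻¹ ^ 29) *
        (2 * (10 : ℝ)⁻¹ ^ 8 + ((rlo.ω₁ : ℝ) * (![(s₀ : ℝ), ((s₀ : ℝ) + s₂) / 2, (s₂ : ℝ)] k + (10 : ℝ)⁻¹ ^ 10) ^ 2 +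
          (ω₁ : ℝ) * (![(u₀ : ℝ), ((u₀ : ℝ) + u₂) / 2, (u₂ : ℝ)] k + (10 : ℝ)⁻¹ ^ 10) ^ 2)) ≤ bS k) :
    (∀ (σ : Fin 2) (p₀ : GridPoint L (2 * (2 * M))), ∑ p₁ : GridPoint L (2 * (2 * M)),
      (if p₁ = p₀ then (0 : ℝ) else (if p₁.2 - p₀.2 = 0 then (0 : ℝ) else 1) * ‖contr ℂ ((hubbardGridSub L M β (2 * (2 * M))).transpose * hubbardCovAboveCT L M β μ 0 0 klE0 *
                hubbardGridSub L M β (2 * (2 * M))) (((p₁, σ), 0) : GridLeg (GridPoint L (2 * (2 * M)))) ((p₀, σ), 1) *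
              (contr ℂ ((hubbardGridSub L M β (2 * (2 * M))).transpose * hubbardCovAboveCT L M β μ 0 0 klE0 *
                hubbardGridSub L M β (2 * (2 * M))) (((p₀, σ.rev), 0) : GridLeg (GridPoint L (2 * (2 * M)))) ((p₁, σ.rev), 1) *
                contr ℂ ((hubbardGridSub L M β (2 * (2 * M))).transpose * hubbardCovAboveCT L M β μ 0 0 klE0 *
                hubbardGridSub L M β (2 * (2 * M))) (((p₁, σ.rev), 0) : GridLeg (GridPoint L (2 * (2 * M)))) ((p₀, σ.rev), 1))‖) ≤ bS 0 * (((2 * (2 * M) : ℕ) : ℝ) / β)) ∧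
    (∀ k, 1 ≤ k → k ≤ 2 → ∀ (σ : Fin 2) (p₀ : GridPoint L (2 * (2 * M))), ∑ p₁ : GridPoint L (2 * (2 * M)),
      (if p₁ = p₀ then (0 : ℝ) else
        Real.sqrt ((((p₁.2 - p₀.2) 0).valMinAbs.natAbs : ℝ) ^ 2 + (((p₁.2 - p₀.2) 1).valMinAbs.natAbs : ℝ) ^ 2) ^ k * ‖contr ℂ ((hubbardGridSub L M β (2 * (2 * M))).transpose * hubbardCovAboveCT L M β μ 0 0 klE0 *
                hubbardGridSub L M β (2 * (2 * M))) (((p₁, σ), 0) : GridLeg (GridPoint L (2 * (2 * M)))) ((p₀, σ), 1) *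
              (contr ℂ ((hubbardGridSub L M β (2 * (2 * M))).transpose * hubbardCovAboveCT L M β μ 0 0 klE0 *
                hubbardGridSub L M β (2 * (2 * M))) (((p₀, σ.rev), 0) : GridLeg (GridPoint L (2 * (2 * M)))) ((p₁, σ.rev), 1) *
                contr ℂ ((hubbardGridSub L M β (2 * (2 * M))).transpose * hubbardCovAboveCT L M β μ 0 0 klE0 *
                hubbardGridSub L M β (2 * (2 * M))) (((p₁, σ.rev), 0) : GridLeg (GridPoint L (2 * (2 * M)))) ((p₀, σ.rev), 1))‖) ≤
        bS k * (((2 * (2 * M) : ℕ) : ℝ) / β)) := by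
  -- `Rc ≥ 1019 > 0` from `255 ≤ ω₁(Rc+1)`, `ω₁ ≤ 1/4`
  have hRcpos : 0 < c.Rc := by
    have h1 : (255 : ℚ) ≤ (1 / 4) * ((c.Rc : ℚ) + 1) := hωRc.trans (mul_le_mul_of_nonneg_right hω₁' (by positivity))
    have h2 : (1019 : ℚ) ≤ (c.Rc : ℚ) := by linarith
    exact_mod_cast (show (0 : ℚ) < c.Rc by linarith)
  have hω₀pos : 0 < rlo.ω₁ := lt_of_lt_of_le (by norm_num) hω₀
  -- the outer record, built from the rational majorants, and its PROVED certificate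
  have hrmid := midShell_farGapCertOn_of_rat c.toSunsetCellRecordV2 hRcpos rlo ⟨ω₁, u₀ ^ 2, u₂ ^ 2⟩ hω₀ hu₀ hu₂
  exact sunsetRows_of_records3_farSup (L := L) (M := M) c hc rlo hrlo ⟨ω₁, u₀ ^ 2, u₂ ^ 2⟩ hrmid rs hrs hμ hμlo hμhi hβ hU0 hU hL3 hM3
    hRc' hTmax hrow hω₀pos hω₁ hω₁' hωRc hG₂lo (sq_nonneg u₂) hs₀ hs₂ hs₀0 hs₂0 le_rfl le_rfl hu₀0 hu₂0 hSfar hbS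


end OneCall

/-! ## §2 Bundles of the inner-gap format: decidable side conditions -/

namespace SunsetCellBundle

/-- The outer square-root majorant vector `v = (u₀, (u₀+u₂)/2, u₂)`. [cite: BenfattoGiulianiMastropietro2006, §2.3-§2.4] -/
def vVec (u₀ u₂ : ℚ) (k : Fin 3) : ℚ := ![u₀, (u₀ + u₂) / 2, u₂] k

/-- **The rational left-hand side of the budget row** of `sunsetRows_of_records_innerGap_farSup`:
`row k + (Sfar + 10⁻²⁹)·(2·10⁻⁸ + (ω₀(t_k + 10⁻¹⁰)² + ω₁(v_k + 10⁻¹⁰)²))`, `ω₀ = b.r.ω₁`. [cite: BenfattoGiulianiMastropietro2006, §2.3-§2.4] -/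
def budget3 (b : SunsetCellBundle) (rs : SunsetFarSupRecord) (ω₁ u₀ u₂ : ℚ) (k : Fin 3) : ℚ :=
  b.c.row k + (rs.Sfar + 10⁻¹ ^ 29) * (2 * 10⁻¹ ^ 8 + (b.r.ω₁ * (b.tVec k + 10⁻¹ ^ 10) ^ 2 + ω₁ * (vVec u₀ u₂ k + 10⁻¹ ^ 10) ^ 2))

/-- **ALL rational side conditions of the inner-gap one-call, as one proposition** (`norm_num` / `decide` on literals). [cite: BenfattoGiulianiMastropietro2006, §2.3-§2.4] -/
def SideOK3 (b : SunsetCellBundle) (rs : SunsetFarSupRecord) (ω₁ u₀ u₂ : ℚ) : Prop :=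
  4 * b.c.Rc + 2 ≤ 2 ^ 10 * 129 ^ 2 * (2 ^ 20 + 1) ^ 2 ∧
  (10 : ℚ)⁻¹ ^ 30 ≤ b.c.Tmax ∧ (0 ≤ b.c.row 0 ∧ 0 ≤ b.c.row 1 ∧ 0 ≤ b.c.row 2) ∧
  ((1 : ℚ) / 32 ≤ b.r.ω₁ ∧ (1 : ℚ) / 32 ≤ ω₁ ∧ ω₁ ≤ 1 / 4 ∧ 255 ≤ ω₁ * ((b.c.Rc : ℚ) + 1) ∧ 0 ≤ b.r.G₂) ∧
  (b.r.G₀ ≤ b.s₀ ^ 2 ∧ b.r.G₂ ≤ b.s₂ ^ 2 ∧ 0 ≤ b.s₀ ∧ 0 ≤ b.s₂) ∧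
  ((6144 / b.r.ω₁ ^ 5 + 4608 / b.r.ω₁ ^ 4 + 896 / b.r.ω₁ ^ 3 + 32 / b.r.ω₁ ^ 2) ^ 2 / (128 * (b.c.Rc : ℚ) ^ 8) ≤ u₀ ^ 2 ∧
    (6144 / b.r.ω₁ ^ 5 + 4608 / b.r.ω₁ ^ 4 + 896 / b.r.ω₁ ^ 3 + 32 / b.r.ω₁ ^ 2) ^ 2 / (64 * (b.c.Rc : ℚ) ^ 6) ≤ u₂ ^ 2 ∧ 0 ≤ u₀ ∧ 0 ≤ u₂) ∧
  0 ≤ rs.Sfar ∧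
  (b.budget3 rs ω₁ u₀ u₂ 0 ≤ b.bS 0 ∧ b.budget3 rs ω₁ u₀ u₂ 1 ≤ b.bS 1 ∧ b.budget3 rs ω₁ u₀ u₂ 2 ≤ b.bS 2)

/-- The cast of the outer majorant vector. [cite: BenfattoGiulianiMastropietro2006, §2.3-§2.4] -/
theorem vVec_cast (u₀ u₂ : ℚ) (k : Fin 3) : ((vVec u₀ u₂ k : ℚ) : ℝ) = ![(u₀ : ℝ), ((u₀ : ℝ) + u₂) / 2, (u₂ : ℝ)] k := by
  fin_cases k <;> simp [vVec]

/-- The cast of the budget row of the inner-gap format. [cite: BenfattoGiulianiMastropietro2006, §2.3-§2.4] -/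
theorem budget3_cast (b : SunsetCellBundle) (rs : SunsetFarSupRecord) (ω₁ u₀ u₂ : ℚ) (k : Fin 3) :
    ((b.budget3 rs ω₁ u₀ u₂ k : ℚ) : ℝ) = (b.c.row k : ℝ) +
      ((rs.Sfar : ℝ) + (10 : ℝ)⁻¹ ^ 29) *
        (2 * (10 : ℝ)⁻¹ ^ 8 + ((b.r.ω₁ : ℝ) * (![(b.s₀ : ℝ), ((b.s₀ : ℝ) + b.s₂) / 2, (b.s₂ : ℝ)] k + (10 : ℝ)⁻¹ ^ 10) ^ 2 +
          (ω₁ : ℝ) * (![(u₀ : ℝ), ((u₀ : ℝ) + u₂) / 2, (u₂ : ℝ)] k + (10 : ℝ)⁻¹ ^ 10) ^ 2)) := by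
  rw [← tVec_cast, ← vVec_cast]
  simp only [budget3]
  push_cast
  ring

end SunsetCellBundle

/-! ## §3 The one-call per bundle and at every `μ` of the window -/

section Window

variable {L M : ℕ} [NeZero L]

/-- **The per-cell one-call of the inner-gap format for a bundle** whose `SideOK3` holds. [cite: BenfattoGiulianiMastropietro2006, §2.3-§2.4] -/
theorem sunsetRows_of_bundle_innerGap [NeZero M] (b : SunsetCellBundle) (rs : SunsetFarSupRecord) (ω₁ u₀ u₂ : ℚ)
    (hc : ScaleZeroSunsetCertV3 b.c) (hr : ScaleZeroFarGapCert b.c.toSunsetCellRecordV2 b.r)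
    (hrs : ScaleZeroFarSupCert b.c.toSunsetCellRecordV2 rs) (hside : b.SideOK3 rs ω₁ u₀ u₂)
    {μ β U : ℝ} (hμ : μ ∈ klWindowC) (hμlo : (b.c.μlo : ℝ) ≤ μ) (hμhi : μ ≤ b.c.μhi)
    (hβ : klBetaMin ≤ β) (hU0 : 0 < U) (hU : U ≤ (2 : ℝ)⁻¹ ^ 20) (hL3 : klEngL₃ β U ≤ L) (hM3 : klEngM₃ β U L ≤ M) :
    (∀ (σ : Fin 2) (p₀ : GridPoint L (2 * (2 * M))), ∑ p₁ : GridPoint L (2 * (2 * M)),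
      (if p₁ = p₀ then (0 : ℝ) else (if p₁.2 - p₀.2 = 0 then (0 : ℝ) else 1) * ‖contr ℂ ((hubbardGridSub L M β (2 * (2 * M))).transpose * hubbardCovAboveCT L M β μ 0 0 klE0 *
                hubbardGridSub L M β (2 * (2 * M))) (((p₁, σ), 0) : GridLeg (GridPoint L (2 * (2 * M)))) ((p₀, σ), 1) *
              (contr ℂ ((hubbardGridSub L M β (2 * (2 * M))).transpose * hubbardCovAboveCT L M β μ 0 0 klE0 *
                hubbardGridSub L M β (2 * (2 * M))) (((p₀, σ.rev), 0) : GridLeg (GridPoint L (2 * (2 * M)))) ((p₁, σ.rev), 1) *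
                contr ℂ ((hubbardGridSub L M β (2 * (2 * M))).transpose * hubbardCovAboveCT L M β μ 0 0 klE0 *
                hubbardGridSub L M β (2 * (2 * M))) (((p₁, σ.rev), 0) : GridLeg (GridPoint L (2 * (2 * M)))) ((p₀, σ.rev), 1))‖) ≤ b.bSℝ 0 * (((2 * (2 * M) : ℕ) : ℝ) / β)) ∧
    (∀ k, 1 ≤ k → k ≤ 2 → ∀ (σ : Fin 2) (p₀ : GridPoint L (2 * (2 * M))), ∑ p₁ : GridPoint L (2 * (2 * M)),
      (if p₁ = p₀ then (0 : ℝ) else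
        Real.sqrt ((((p₁.2 - p₀.2) 0).valMinAbs.natAbs : ℝ) ^ 2 + (((p₁.2 - p₀.2) 1).valMinAbs.natAbs : ℝ) ^ 2) ^ k * ‖contr ℂ ((hubbardGridSub L M β (2 * (2 * M))).transpose * hubbardCovAboveCT L M β μ 0 0 klE0 *
                hubbardGridSub L M β (2 * (2 * M))) (((p₁, σ), 0) : GridLeg (GridPoint L (2 * (2 * M)))) ((p₀, σ), 1) *
              (contr ℂ ((hubbardGridSub L M β (2 * (2 * M))).transpose * hubbardCovAboveCT L M β μ 0 0 klE0 *
                hubbardGridSub L M β (2 * (2 * M))) (((p₀, σ.rev), 0) : GridLeg (GridPoint L (2 * (2 * M)))) ((p₁, σ.rev), 1) *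
                contr ℂ ((hubbardGridSub L M β (2 * (2 * M))).transpose * hubbardCovAboveCT L M β μ 0 0 klE0 *
                hubbardGridSub L M β (2 * (2 * M))) (((p₁, σ.rev), 0) : GridLeg (GridPoint L (2 * (2 * M)))) ((p₀, σ.rev), 1))‖) ≤
        b.bSℝ k * (((2 * (2 * M) : ℕ) : ℝ) / β)) := by
  obtain ⟨hRc', hTmax, ⟨hrow0, hrow1, hrow2⟩, ⟨hω₀, hω₁, hω₁', hωRc, hG₂⟩, ⟨hs₀, hs₂, hs₀0, hs₂0⟩, ⟨hu₀, hu₂, hu₀0, hu₂0⟩, hSfar, ⟨hb0, hb1, hb2⟩⟩ :=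
    hside
  have hrow : ∀ k : Fin 3, 0 ≤ b.c.row k := by
    intro k; fin_cases k
    · exact hrow0
    · exact hrow1
    · exact hrow2
  have hbSq : ∀ k : Fin 3, b.budget3 rs ω₁ u₀ u₂ k ≤ b.bS k := by
    intro k; fin_cases k
    · exact hb0
    · exact hb1
    · exact hb2
  have hbS : ∀ k : Fin 3, (b.c.row k : ℝ) +
      ((rs.Sfar : ℝ) + (10 : ℝ)⁻¹ ^ 29) *
        (2 * (10 : ℝ)⁻¹ ^ 8 + ((b.r.ω₁ : ℝ) * (![(b.s₀ : ℝ), ((b.s₀ : ℝ) + b.s₂) / 2, (b.s₂ : ℝ)] k + (10 : ℝ)⁻¹ ^ 10) ^ 2 +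
          (ω₁ : ℝ) * (![(u₀ : ℝ), ((u₀ : ℝ) + u₂) / 2, (u₂ : ℝ)] k + (10 : ℝ)⁻¹ ^ 10) ^ 2)) ≤ b.bSℝ k := by
    intro k
    rw [← SunsetCellBundle.budget3_cast, SunsetCellBundle.bSℝ_fin]
    exact_mod_cast hbSq k
  have h := sunsetRows_of_records_innerGap_farSup (L := L) (M := M) b.c hc b.r hr rs hrs hμ hμlo hμhi hβ hU0 hU hL3 hM3
    hRc' hTmax hrow hω₀ hω₁ hω₁' hωRc hG₂ hs₀ hs₂ hs₀0 hs₂0 hu₀ hu₂ hu₀0 hu₂0 hSfar (bS := b.bSℝ) hbS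
  refine ⟨h.1, fun k hk1 hk2 => ?_⟩
  exact h.2 k hk1 hk2

/-- **THE CERTIFIED SUNSET ROWS AT EVERY `μ` OF THE WINDOW, INNER-GAP FORMAT — decidable cover form**: from a list of bundles chain-covering `klWindowC`
(`exists_mem_cell_of_chain` on `l.map (fun b => (b.c.μlo, b.c.μhi))`, ends `-21/20`, `-3/20`), each with its near certificate, INNER far-gap certificate, the far-sup
certificate and `SideOK3 rs ω₁ u₀ u₂`: at every `μ ∈ klWindowC` some bundle contains `μ` and delivers `hS0`/`hSk` with `bS := b.bSℝ`. [cite: BenfattoGiulianiMastropietro2006, §2.3-§2.4] -/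
theorem sunsetRows_window_innerGap_of_chain [NeZero M] (l : List SunsetCellBundle) (rs : SunsetFarSupRecord) (ω₁ u₀ u₂ : ℚ)
    (hne : l.map (fun b => (b.c.μlo, b.c.μhi)) ≠ [])
    (hhead : ∀ c ∈ (l.map (fun b => (b.c.μlo, b.c.μhi))).head?, c.1 ≤ (-21) / 20)
    (hlast : ∀ c ∈ (l.map (fun b => (b.c.μlo, b.c.μhi))).getLast?, (-3) / 20 ≤ c.2)
    (hchain : (l.map (fun b => (b.c.μlo, b.c.μhi))).IsChain (fun c d => d.1 ≤ c.2))
    (hc : ∀ b ∈ l, ScaleZeroSunsetCertV3 b.c) (hr : ∀ b ∈ l, ScaleZeroFarGapCert b.c.toSunsetCellRecordV2 b.r)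
    (hrs : ∀ b ∈ l, ScaleZeroFarSupCert b.c.toSunsetCellRecordV2 rs) (hside : ∀ b ∈ l, b.SideOK3 rs ω₁ u₀ u₂)
    {μ β U : ℝ} (hμ : μ ∈ klWindowC)
    (hβ : klBetaMin ≤ β) (hU0 : 0 < U) (hU : U ≤ (2 : ℝ)⁻¹ ^ 20) (hL3 : klEngL₃ β U ≤ L) (hM3 : klEngM₃ β U L ≤ M) :
    ∃ b ∈ l, ((b.c.μlo : ℝ) ≤ μ ∧ μ ≤ b.c.μhi) ∧
    (∀ (σ : Fin 2) (p₀ : GridPoint L (2 * (2 * M))), ∑ p₁ : GridPoint L (2 * (2 * M)),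
      (if p₁ = p₀ then (0 : ℝ) else (if p₁.2 - p₀.2 = 0 then (0 : ℝ) else 1) * ‖contr ℂ ((hubbardGridSub L M β (2 * (2 * M))).transpose * hubbardCovAboveCT L M β μ 0 0 klE0 *
                hubbardGridSub L M β (2 * (2 * M))) (((p₁, σ), 0) : GridLeg (GridPoint L (2 * (2 * M)))) ((p₀, σ), 1) *
              (contr ℂ ((hubbardGridSub L M β (2 * (2 * M))).transpose * hubbardCovAboveCT L M β μ 0 0 klE0 *
                hubbardGridSub L M β (2 * (2 * M))) (((p₀, σ.rev), 0) : GridLeg (GridPoint L (2 * (2 * M)))) ((p₁, σ.rev), 1) *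
                contr ℂ ((hubbardGridSub L M β (2 * (2 * M))).transpose * hubbardCovAboveCT L M β μ 0 0 klE0 *
                hubbardGridSub L M β (2 * (2 * M))) (((p₁, σ.rev), 0) : GridLeg (GridPoint L (2 * (2 * M)))) ((p₀, σ.rev), 1))‖) ≤ b.bSℝ 0 * (((2 * (2 * M) : ℕ) : ℝ) / β)) ∧
    (∀ k, 1 ≤ k → k ≤ 2 → ∀ (σ : Fin 2) (p₀ : GridPoint L (2 * (2 * M))), ∑ p₁ : GridPoint L (2 * (2 * M)),
      (if p₁ = p₀ then (0 : ℝ) else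
        Real.sqrt ((((p₁.2 - p₀.2) 0).valMinAbs.natAbs : ℝ) ^ 2 + (((p₁.2 - p₀.2) 1).valMinAbs.natAbs : ℝ) ^ 2) ^ k * ‖contr ℂ ((hubbardGridSub L M β (2 * (2 * M))).transpose * hubbardCovAboveCT L M β μ 0 0 klE0 *
                hubbardGridSub L M β (2 * (2 * M))) (((p₁, σ), 0) : GridLeg (GridPoint L (2 * (2 * M)))) ((p₀, σ), 1) *
              (contr ℂ ((hubbardGridSub L M β (2 * (2 * M))).transpose * hubbardCovAboveCT L M β μ 0 0 klE0 *
                hubbardGridSub L M β (2 * (2 * M))) (((p₀, σ.rev), 0) : GridLeg (GridPoint L (2 * (2 * M)))) ((p₁, σ.rev), 1) *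
                contr ℂ ((hubbardGridSub L M β (2 * (2 * M))).transpose * hubbardCovAboveCT L M β μ 0 0 klE0 *
                hubbardGridSub L M β (2 * (2 * M))) (((p₁, σ.rev), 0) : GridLeg (GridPoint L (2 * (2 * M)))) ((p₀, σ.rev), 1))‖) ≤
        b.bSℝ k * (((2 * (2 * M) : ℕ) : ℝ) / β)) := by
  obtain ⟨hν1, hν2⟩ := (mem_klWindowC_iff_rat μ).1 hμ
  obtain ⟨cc, hcc, h1, h2⟩ := exists_mem_cell_of_chain _ _ _ hne hhead hlast hchain μ hν1 hν2
  obtain ⟨b, hb, rfl⟩ := List.mem_map.1 hcc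
  exact ⟨b, hb, ⟨h1, h2⟩, sunsetRows_of_bundle_innerGap (L := L) (M := M) b rs ω₁ u₀ u₂ (hc b hb) (hr b hb) (hrs b hb) (hside b hb)
    hμ h1 h2 hβ hU0 hU hL3 hM3⟩

end Window

end Summit.HubbardSuperconductivity.HubbardSuperconductivity.Theorems.KLRegimeSplit

end
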